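import Mathlib
import Literature.Probability.LatticeModels.GKSInequalities
import HarnessLib

/-!
# Crux `PrecisionLaplacian.InverseMFerromagnet` (stmt-CriticalPhenomena-4798), line `Sketch` —
# stub `stub_condExp_eq_frozen` (S2, "conditioning = freezing")

THEOREM-ONLY file (no definitions).  For the spin system `ν_{Λ;K} ∝ exp (∑ᵢ Kᵢ ω_{Cᵢ})` on
`Λ = Fin n` (`gksExpect univ K C`, `Literature.Probability.LatticeModels.GKSInequalities`), a set
`S` of sites, a prescription `s : ↥S → ℤˣ` of the spins on `S` and a set `T` disjoint from `S`:

`E[σ_T · 1_{σ_S = s}] = P(σ_S = s) · ⟨σ_T⟩'`,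

where `⟨·⟩'` is the system on the SAME index set `Fin m` with couplings
`K'_i = K_i · ∏_{p ∈ S ∩ C_i} s_p` and supports `C'_i = C_i ∖ S`, and the indicator is the spin
polynomial `1_s(ω) = ∏_{p ∈ S} (1 + s_p σ_p(ω)) / 2`.  Pure finite-sum bookkeeping, no sign
hypothesis on `K`: on the cylinder `{ω | ω|_S = s}` the two Boltzmann weights coincide, off it the
indicator vanishes, and the frozen weight and `σ_T` do not depend on `ω|_S`, so that full sums are
`|ℤˣ^S|` times cylinder sums (the partition of unity `∑_s 1_s = 1` is the fact `sum_cyl_eq_one` of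
the sibling file `PrecisionLaplacianInverseMFerromagnetCondCovNonneg`, re-derived inline here to
keep the two stub files independent).
-/

namespace Summit.CriticalPhenomena.Ising3DConformalLimit.Cruxes.InverseMFerromagnet.PartialCovarianceLadder

open Literature.Probability.LatticeModels Finset Matrix

noncomputable section

/-! ## The indicator polynomial of a cylinder and the weights on it -/

/-- Off the cylinder `{ω | ω|_S = s}` the indicator polynomial `∏_{p ∈ S} (1 + s_p σ_p)/2`
vanishes (the factor at a disagreeing site is `(1 - s_p²)/2 = 0`). [folklore] -/
theorem frozen_indicator_eq_zero {n : ℕ} (S : Finset (Fin n)) (s : ↥S → ℤˣ)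
    (ω : SpinConfig (Fin n)) (h : ¬ ∀ p : ↥S, ω p.1 = s p) :
    ∏ p : ↥S, (1 + (((s p : ℤˣ) : ℤ) : ℝ) * spinAt p.1 ω) / 2 = 0 := by
  push Not at h
  obtain ⟨p, hp⟩ := h
  refine Finset.prod_eq_zero (Finset.mem_univ p) ?_
  have hneg : ω p.1 = -s p := by
    rcases Int.units_eq_one_or (ω p.1) with h1 | h1 <;>
      rcases Int.units_eq_one_or (s p) with h2 | h2
    · exact absurd (h1.trans h2.symm) hp
    · rw [h1, h2, neg_neg]
    · rw [h1, h2]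
    · exact absurd (h1.trans h2.symm) hp
  rw [spinAt, hneg, Units.val_neg, Int.cast_neg, mul_neg, ← Int.cast_mul, ← Units.val_mul,
    Int.units_mul_self, Units.val_one, Int.cast_one]
  norm_num

/-- On the cylinder `ω|_S = s`: `σ_A(ω) = σ_{A ∖ S}(ω) · ∏_{p ∈ S ∩ A} s_p`. [folklore] -/
theorem frozen_spinProduct_eq {n : ℕ} (S : Finset (Fin n)) (s : ↥S → ℤˣ)
    (ω : SpinConfig (Fin n)) (hω : ∀ p : ↥S, ω p.1 = s p) (A : Finset (Fin n)) :
    spinProduct A ω =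
      spinProduct (A \ S) ω * ∏ p : ↥S, (if p.1 ∈ A then (((s p : ℤˣ) : ℤ) : ℝ) else 1) := by
  have h1 : ∏ p : ↥S, (if p.1 ∈ A then (((s p : ℤˣ) : ℤ) : ℝ) else 1)
      = ∏ x ∈ A ∩ S, spinAt x ω := by
    have h2 : ∀ p : ↥S, (if p.1 ∈ A then (((s p : ℤˣ) : ℤ) : ℝ) else 1)
        = (if p.1 ∈ A then spinAt p.1 ω else 1) := by
      intro p
      rw [spinAt, hω p]
    rw [Fintype.prod_congr _ _ h2,
      Finset.prod_coe_sort S (fun x => if x ∈ A then spinAt x ω else 1),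
      Finset.prod_ite_mem, Finset.inter_comm]
  have h3 := Finset.prod_sdiff (f := fun x => spinAt x ω)
    (Finset.inter_subset_left (s₁ := A) (s₂ := S))
  rw [Finset.sdiff_inter_self_left] at h3
  rw [h1, spinProduct, spinProduct, ← h3]

/-- On the cylinder `ω|_S = s` the Boltzmann weight equals the frozen Boltzmann weight (couplings
`K_i ∏_{p ∈ S ∩ C_i} s_p` on the supports `C_i ∖ S`). [folklore] -/
theorem frozen_gksWeight_eq {n m : ℕ} (K : Fin m → ℝ) (C : Fin m → Finset (Fin n))
    (S : Finset (Fin n)) (s : ↥S → ℤˣ) (ω : SpinConfig (Fin n)) (hω : ∀ p : ↥S, ω p.1 = s p) :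
    gksWeight Finset.univ K C ω =
      gksWeight Finset.univ
        (fun i => K i * ∏ p : ↥S, (if p.1 ∈ C i then (((s p : ℤˣ) : ℤ) : ℝ) else 1))
        (fun i => C i \ S) ω := by
  simp only [gksWeight, gksHamiltonian]
  congr 1
  refine Finset.sum_congr rfl fun i _ => ?_
  rw [frozen_spinProduct_eq S s ω hω (C i)]
  ring

/-! ## Functions of the spins off `S` -/

/-- The frozen Boltzmann weight does not depend on the spins in `S`. [folklore] -/
theorem frozen_gksWeight_congr {n m : ℕ} (K' : Fin m → ℝ) (C : Fin m → Finset (Fin n))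
    (S : Finset (Fin n)) (ω ω' : SpinConfig (Fin n)) (h : ∀ p, p ∉ S → ω p = ω' p) :
    gksWeight Finset.univ K' (fun i => C i \ S) ω = gksWeight Finset.univ K' (fun i => C i \ S) ω' := by
  simp only [gksWeight, gksHamiltonian, spinProduct]
  congr 1
  refine Finset.sum_congr rfl fun i _ => ?_
  congr 1
  refine Finset.prod_congr rfl fun x hx => ?_
  rw [spinAt, spinAt, h x (Finset.mem_sdiff.1 hx).2]

/-- `σ_T` does not depend on the spins in `S` if `T ∩ S = ∅`. [folklore] -/
theorem frozen_spinProduct_congr {n : ℕ} (S T : Finset (Fin n)) (hTS : Disjoint T S)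
    (ω ω' : SpinConfig (Fin n)) (h : ∀ p, p ∉ S → ω p = ω' p) :
    spinProduct T ω = spinProduct T ω' := by
  simp only [spinProduct]
  refine Finset.prod_congr rfl fun x hx => ?_
  rw [spinAt, spinAt, h x (Finset.disjoint_left.1 hTS hx)]

/-- All cylinders carry the same sum of a function of the spins off `S`: flipping the spins of `S`
where `t ≠ s` maps the `t`-cylinder onto the `s`-cylinder. [folklore] -/
theorem frozen_sum_indicator_mul_eq {n : ℕ} (S : Finset (Fin n)) (s t : ↥S → ℤˣ)
    (F : SpinConfig (Fin n) → ℝ)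
    (hF : ∀ ω ω' : SpinConfig (Fin n), (∀ p, p ∉ S → ω p = ω' p) → F ω = F ω') :
    ∑ ω : SpinConfig (Fin n), (∏ p : ↥S, (1 + (((t p : ℤˣ) : ℤ) : ℝ) * spinAt p.1 ω) / 2) * F ω =
      ∑ ω : SpinConfig (Fin n), (∏ p : ↥S, (1 + (((s p : ℤˣ) : ℤ) : ℝ) * spinAt p.1 ω) / 2) * F ω := by
  set τ : SpinConfig (Fin n) := fun q => if h : q ∈ S then t ⟨q, h⟩ * s ⟨q, h⟩ else 1 with hτ
  refine Fintype.sum_equiv (Equiv.mulRight τ) _ _ fun ω => ?_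
  simp only [Equiv.coe_mulRight]
  have hoff : ∀ p, p ∉ S → ω p = (ω * τ) p := by
    intro p hp
    simp only [hτ, Pi.mul_apply, dif_neg hp, mul_one]
  rw [hF ω (ω * τ) hoff]
  congr 1
  refine Fintype.prod_congr _ _ fun p => ?_
  have hp : (ω * τ) p.1 = ω p.1 * (t p * s p) := by
    simp only [hτ, Pi.mul_apply, dif_pos p.2, Subtype.coe_eta]
  have hsq : (((s p : ℤˣ) : ℤ) : ℝ) * (((s p : ℤˣ) : ℤ) : ℝ) = 1 := by
    rw [← Int.cast_mul, ← Units.val_mul, Int.units_mul_self, Units.val_one, Int.cast_one]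
  rw [spinAt, spinAt, hp, Units.val_mul, Units.val_mul, Int.cast_mul, Int.cast_mul]
  linear_combination (-((((t p : ℤˣ) : ℤ) : ℝ) * (((ω p.1 : ℤˣ) : ℤ) : ℝ)) / 2) * hsq

/-- **Full sums versus cylinder sums.** For a function `F` of the spins off `S`,
`∑_ω F(ω) = |ℤˣ^S| · ∑_ω 1_s(ω) F(ω)`. [folklore] -/
theorem frozen_sum_eq_card_mul {n : ℕ} (S : Finset (Fin n)) (s : ↥S → ℤˣ)
    (F : SpinConfig (Fin n) → ℝ)
    (hF : ∀ ω ω' : SpinConfig (Fin n), (∀ p, p ∉ S → ω p = ω' p) → F ω = F ω') :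
    ∑ ω : SpinConfig (Fin n), F ω =
      (Fintype.card (↥S → ℤˣ) : ℝ) *
        ∑ ω : SpinConfig (Fin n), (∏ p : ↥S, (1 + (((s p : ℤˣ) : ℤ) : ℝ) * spinAt p.1 ω) / 2) * F ω := by
  calc ∑ ω : SpinConfig (Fin n), F ω
      = ∑ ω : SpinConfig (Fin n),
          (∑ t : ↥S → ℤˣ, ∏ p : ↥S, (1 + (((t p : ℤˣ) : ℤ) : ℝ) * spinAt p.1 ω) / 2) * F ω := by
        refine Finset.sum_congr rfl fun ω _ => ?_
        -- partition of unity `∑_t 1_t(ω) = ∏_{p ∈ S} ∑_{u = ±1} (1 + u σ_p(ω))/2 = 1`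
        have hone : ∑ t : ↥S → ℤˣ,
            ∏ p : ↥S, (1 + (((t p : ℤˣ) : ℤ) : ℝ) * spinAt p.1 ω) / 2 = 1 := by
          rw [← Fintype.prod_sum (fun (p : ↥S) (u : ℤˣ) => (1 + ((u : ℤ) : ℝ) * spinAt p.1 ω) / 2)]
          refine Finset.prod_eq_one fun p _ => ?_
          rw [UnitsInt.univ, Finset.sum_pair (by decide)]
          simp only [Units.val_one, Int.cast_one, one_mul, Units.val_neg, Int.cast_neg, neg_mul]
          ring
        rw [hone, one_mul]
    _ = ∑ t : ↥S → ℤˣ, ∑ ω : SpinConfig (Fin n),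
          (∏ p : ↥S, (1 + (((t p : ℤˣ) : ℤ) : ℝ) * spinAt p.1 ω) / 2) * F ω := by
        rw [Finset.sum_comm]
        refine Finset.sum_congr rfl fun ω _ => ?_
        rw [Finset.sum_mul]
    _ = ∑ _t : ↥S → ℤˣ, ∑ ω : SpinConfig (Fin n),
          (∏ p : ↥S, (1 + (((s p : ℤˣ) : ℤ) : ℝ) * spinAt p.1 ω) / 2) * F ω :=
        Finset.sum_congr rfl fun t _ => frozen_sum_indicator_mul_eq S s t F hF
    _ = _ := by
        rw [Finset.sum_const, Finset.card_univ, nsmul_eq_mul]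

/-! ## Conditioning = freezing -/

/-- The algebra of the assembly: if two weights `w, w'` agree against the indicator `ind`, and full
`w'`-sums of `σ` and `1` are `N` times their `ind`-restricted sums, then
`(∑ σ·ind·w)/(∑ w) = (∑ ind·w)/(∑ w) · (∑ σ·w')/(∑ w')`. [folklore] -/
theorem frozen_assembly {Ω : Type*} [Fintype Ω] (ind σ w w' : Ω → ℝ) (N : ℝ)
    (hw : ∀ ω, ind ω * w ω = ind ω * w' ω)
    (hnum : ∑ ω, σ ω * w' ω = N * ∑ ω, ind ω * (σ ω * w' ω))
    (hden : ∑ ω, 1 * w' ω = N * ∑ ω, ind ω * (1 * w' ω))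
    (hZ' : 0 < ∑ ω, 1 * w' ω) :
    (∑ ω, (σ ω * ind ω) * w ω) / (∑ ω, 1 * w ω) =
      (∑ ω, ind ω * w ω) / (∑ ω, 1 * w ω) * ((∑ ω, σ ω * w' ω) / (∑ ω, 1 * w' ω)) := by
  have h1 : ∑ ω, (σ ω * ind ω) * w ω = ∑ ω, ind ω * (σ ω * w' ω) :=
    Finset.sum_congr rfl fun ω _ => by rw [mul_assoc, hw ω]; ring
  have h2 : ∑ ω, ind ω * w ω = ∑ ω, ind ω * (1 * w' ω) :=
    Finset.sum_congr rfl fun ω _ => by rw [hw ω, one_mul]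
  have hpos : 0 < N * ∑ ω, ind ω * (1 * w' ω) := hden ▸ hZ'
  have hN : N ≠ 0 := (mul_ne_zero_iff.1 hpos.ne').1
  have hY : ∑ ω, ind ω * (1 * w' ω) ≠ 0 := (mul_ne_zero_iff.1 hpos.ne').2
  rw [h1, h2, hnum, hden, mul_div_mul_left _ _ hN, div_mul_div_comm, mul_comm (∑ ω, 1 * w ω),
    mul_div_mul_left _ _ hY]

/-- **S2 · Conditioning on `σ_S = s` is freezing.** For `T ∩ S = ∅`,
`E[σ_T · 1_{σ_S = s}] = P(σ_S = s) · ⟨σ_T⟩'`, where `⟨·⟩'` has couplings `K_i ∏_{p ∈ S ∩ C_i} s_p`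
on the supports `C_i ∖ S` and `1_{σ_S = s} = ∏_{p ∈ S} (1 + s_p σ_p)/2`. [folklore] -/
theorem stub_condExp_eq_frozen : ∀ (n m : ℕ) (K : Fin m → ℝ) (C : Fin m → Finset (Fin n)) (S T : Finset (Fin n)), Disjoint T S → ∀ s : ↥S → ℤˣ, gksExpect Finset.univ K C (fun ω => spinProduct T ω * ∏ p : ↥S, (1 + (((s p : ℤˣ) : ℤ) : ℝ) * spinAt p.1 ω) / 2) = gksExpect Finset.univ K C (fun ω => ∏ p : ↥S, (1 + (((s p : ℤˣ) : ℤ) : ℝ) * spinAt p.1 ω) / 2) * gksExpect Finset.univ (fun i => K i * ∏ p : ↥S, (if p.1 ∈ C i then (((s p : ℤˣ) : ℤ) : ℝ) else 1)) (fun i => C i \ S) (spinProduct T) := by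
  intro n m K C S T hTS s
  set K' : Fin m → ℝ :=
    fun i => K i * ∏ p : ↥S, (if p.1 ∈ C i then (((s p : ℤˣ) : ℤ) : ℝ) else 1) with hK'
  -- the two weights agree against the indicator
  have hw : ∀ ω : SpinConfig (Fin n),
      (∏ p : ↥S, (1 + (((s p : ℤˣ) : ℤ) : ℝ) * spinAt p.1 ω) / 2) * gksWeight Finset.univ K C ω =
        (∏ p : ↥S, (1 + (((s p : ℤˣ) : ℤ) : ℝ) * spinAt p.1 ω) / 2) *
          gksWeight Finset.univ K' (fun i => C i \ S) ω := by
    intro ω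
    by_cases hω : ∀ p : ↥S, ω p.1 = s p
    · rw [frozen_gksWeight_eq K C S s ω hω]
    · rw [frozen_indicator_eq_zero S s ω hω, zero_mul, zero_mul]
  -- independence of the frozen weight and of `σ_T` from the spins in `S`
  have hF1 : ∀ ω ω' : SpinConfig (Fin n), (∀ p, p ∉ S → ω p = ω' p) →
      spinProduct T ω * gksWeight Finset.univ K' (fun i => C i \ S) ω =
        spinProduct T ω' * gksWeight Finset.univ K' (fun i => C i \ S) ω' := by
    intro ω ω' h
    rw [frozen_spinProduct_congr S T hTS ω ω' h, frozen_gksWeight_congr K' C S ω ω' h]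
  have hF2 : ∀ ω ω' : SpinConfig (Fin n), (∀ p, p ∉ S → ω p = ω' p) →
      1 * gksWeight Finset.univ K' (fun i => C i \ S) ω =
        1 * gksWeight Finset.univ K' (fun i => C i \ S) ω' := by
    intro ω ω' h
    rw [frozen_gksWeight_congr K' C S ω ω' h]
  have hnum := frozen_sum_eq_card_mul S s
    (fun ω => spinProduct T ω * gksWeight Finset.univ K' (fun i => C i \ S) ω) hF1
  have hden := frozen_sum_eq_card_mul S s
    (fun ω => 1 * gksWeight Finset.univ K' (fun i => C i \ S) ω) hF2
  have hZ' := gksSum_one_pos Finset.univ K' (fun i => C i \ S)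
  simp only [gksExpect, gksSum] at hZ' ⊢
  exact frozen_assembly (fun ω => ∏ p : ↥S, (1 + (((s p : ℤˣ) : ℤ) : ℝ) * spinAt p.1 ω) / 2)
    (spinProduct T) (gksWeight Finset.univ K C) (gksWeight Finset.univ K' (fun i => C i \ S))
    (Fintype.card (↥S → ℤˣ) : ℝ) hw hnum hden hZ'

end

end Summit.CriticalPhenomena.Ising3DConformalLimit.Cruxes.InverseMFerromagnet.PartialCovarianceLadder
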